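import Mathlib
import Summits.ResolutionOfSingularities.ResolutionOfSingularities.Theorems.HomologicalConductorNoZenoFullSheafFunctor
import HarnessLib

/-!
# Crux `NoZenoR` (stmt-ResolutionOfSingularities-19943), line `sandwich-cluster`, G-layer:
# `End_T(M) → End(M~)` — the `K`-linear extension of an endomorphism and the induced sheaf map (G2 (v), A4 forward half)

OURS (cell res-hironaka, chain W4.4; KERNEL-L0 §16 R6 row G2, holder res-D-pv-045 AS res-L0-w44-stub-8;
plan `D/res-D-pv-045/SketchG2Assembly.lean` A4). Nothing of [claim: Hironaka2017] is used.

Setting (pure linear algebra first): `T` a domain, `K` a fraction field of `T` (in the application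
`K = K(X) = Frac T` along `baseToFunctionField π`, tree `isFractionRing_baseToFunctionField`; the `T`-structures
are instance ARGUMENTS here, supplied by the user with `letI := (baseToFunctionField π).toAlgebra` etc.), `V` a
`K`-vector space with the compatible `T`-module structure, `φ : M →ₗ[T] V` injective with `K · φ(M) = V`.

* **`isLocalizedModule_of_span_eq_top`** — such a `φ` is a localization of `M` at `T ∖ 0` (`V = K ⊗_T M`):
  non-zero scalars act invertibly on `V`, every `v ∈ K · φ(M)` has a `T`-multiple in `φ(M)` (clear
  denominators, `IsFractionRing.div_surjective`), `φ` injective;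
* **`endLift φ … u : V →ₗ[K] V`** — the unique `K`-linear extension of `u ∈ End_T(M)` (Mathlib
  `IsLocalizedModule.map` + `LinearMap.extendScalarsOfIsLocalization`): `endLift_apply_map` (`ū (φ m) = φ (u m)`),
  `endLift_mapsTo`, `endLift_unique`, `endLift_one`, `endLift_mul`, `endLift_add`, `endLift_smul`;
* for `K = K(X)`: **`sheafEnd φ … u : M~ ⟶ M~`**, `M~ = 𝒪_X · φ(M)` (`mapOfLinear`, p504295), with
  `fn_sheafEnd_app`, `sheafEnd_app_ofMem` (`σ_{φ m} ↦ σ_{φ (u m)}`), `sheafEnd_one`, `sheafEnd_mul`, `sheafEnd_add`.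

The inverse direction `End(M~) → End_T(M)` uses (ii) `Γ(X, M~) = φ(M)` and is assembled separately.
Everything is proved; no named facts. [this work]
-/

-- single-problem summit: the doubled namespace component `ResolutionOfSingularities` is forced
set_option linter.dupNamespace false

noncomputable section

universe u v w

open CategoryTheory AlgebraicGeometry TopologicalSpace Opposite

namespace Summit.ResolutionOfSingularities.ResolutionOfSingularities.Theorems.NoZeno.SandwichCluster.FullSheaf

section LinearAlgebra

variable {T : Type u} [CommRing T] [IsDomain T] {K : Type v} [Field K] [Algebra T K] [IsFractionRing T K]
variable {V : Type w} [AddCommGroup V] [Module K V] [Module T V] [IsScalarTower T K V]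
variable {M : Type*} [AddCommGroup M] [Module T M] (φ : M →ₗ[T] V)

/-- **`φ : M → V` is a localization of `M` at the non-zero-divisors of `T`** (`V = K ⊗_T M`) when `φ` is
injective and `K · φ(M) = V`, `K = Frac T`. [folklore] -/
theorem isLocalizedModule_of_span_eq_top (hφinj : Function.Injective φ)
    (hspan : Submodule.span K (Set.range φ) = ⊤) : IsLocalizedModule (nonZeroDivisors T) φ := by
  refine ⟨fun s => ?_, fun y => ?_, fun {x₁ x₂} h => ⟨1, by simpa using hφinj h⟩⟩
  · -- non-zero scalars act invertibly on the `K`-vector space `V`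
    have hs : (algebraMap T K (s : T)) ≠ 0 := IsFractionRing.to_map_ne_zero_of_mem_nonZeroDivisors s.2
    have hsmul : ∀ v : V, (s : T) • v = algebraMap T K (s : T) • v := fun v => (algebraMap_smul K (s : T) v).symm
    refine (Module.End.isUnit_iff _).mpr ⟨fun v w hvw => ?_, fun v => ⟨(algebraMap T K s)⁻¹ • v, ?_⟩⟩
    · have h' : algebraMap T K (s : T) • v = algebraMap T K (s : T) • w := by
        rw [← hsmul, ← hsmul]; exact hvw
      exact smul_right_injective V hs h'
    · change (s : T) • ((algebraMap T K (s : T))⁻¹ • v) = v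
      rw [hsmul, ← mul_smul, mul_inv_cancel₀ hs, one_smul]
  · -- clear denominators: every `y ∈ V = K · φ(M)` has `s • y ∈ φ(M)`
    have hy : y ∈ Submodule.span K (Set.range φ) := by rw [hspan]; trivial
    induction hy using Submodule.span_induction with
    | mem w hw =>
      obtain ⟨m, rfl⟩ := hw
      exact ⟨⟨m, 1⟩, by simp⟩
    | zero => exact ⟨⟨0, 1⟩, by simp⟩
    | add w w' _ _ hw hw' =>
      obtain ⟨⟨m, s⟩, hms⟩ := hw
      obtain ⟨⟨m', s'⟩, hms'⟩ := hw'
      refine ⟨⟨(s' : T) • m + (s : T) • m', s * s'⟩, ?_⟩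
      simp only [Submonoid.smul_def, map_add, LinearMap.map_smul, smul_add, mul_smul]
        at hms hms' ⊢
      rw [← hms, ← hms', smul_comm (s : T) (s' : T) w]
    | smul k w _ hw =>
      obtain ⟨⟨m, s⟩, hms⟩ := hw
      obtain ⟨a, b, hb, rfl⟩ := IsFractionRing.div_surjective (A := T) k
      refine ⟨⟨a • m, ⟨b, hb⟩ * s⟩, ?_⟩
      simp only [Submonoid.smul_def, Submonoid.coe_mul, LinearMap.map_smul] at hms ⊢
      have hb0 : algebraMap T K b ≠ 0 := IsFractionRing.to_map_ne_zero_of_mem_nonZeroDivisors hb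
      rw [← hms, ← algebraMap_smul K (b * (s : T)), ← algebraMap_smul K a, ← algebraMap_smul K (s : T),
        ← mul_smul, ← mul_smul]
      congr 1
      rw [map_mul]
      field_simp

variable (hφinj : Function.Injective φ) (hspan : Submodule.span K (Set.range φ) = ⊤)
include hφinj hspan

/-- **`endLift u : V →ₗ[K] V`, the `K`-linear extension of `u ∈ End_T(M)` along `φ`.** [folklore] -/
def endLift (u : Module.End T M) : V →ₗ[K] V :=
  haveI := isLocalizedModule_of_span_eq_top φ hφinj hspan
  (IsLocalizedModule.map (nonZeroDivisors T) φ φ u).extendScalarsOfIsLocalization (nonZeroDivisors T) K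

/-- `ū (φ m) = φ (u m)`. [folklore] -/
@[simp]
theorem endLift_apply_map (u : Module.End T M) (m : M) : endLift φ hφinj hspan u (φ m) = φ (u m) := by
  haveI := isLocalizedModule_of_span_eq_top φ hφinj hspan
  change IsLocalizedModule.map (nonZeroDivisors T) φ φ u (φ m) = φ (u m)
  rw [IsLocalizedModule.map_apply]

/-- `ū` maps `φ(M)` into itself. [folklore] -/
theorem endLift_mapsTo (u : Module.End T M) :
    Set.MapsTo (endLift φ hφinj hspan u) (Set.range φ) (Set.range φ) := by
  rintro _ ⟨m, rfl⟩
  exact ⟨u m, (endLift_apply_map φ hφinj hspan u m).symm⟩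

/-- **Uniqueness**: a `K`-linear map agreeing with `φ ∘ u` on `φ(M)` is `ū` (`φ(M)` spans `V`). [folklore] -/
theorem endLift_unique (u : Module.End T M) (ψ : V →ₗ[K] V) (hψ : ∀ m : M, ψ (φ m) = φ (u m)) :
    ψ = endLift φ hφinj hspan u := by
  refine LinearMap.ext_on_range hspan fun m => ?_
  rw [hψ, endLift_apply_map]

/-- `ū = id` for `u = 1`. [folklore] -/
theorem endLift_one : endLift φ hφinj hspan 1 = LinearMap.id :=
  (endLift_unique φ hφinj hspan 1 LinearMap.id fun _ => rfl).symm

/-- `ū` is multiplicative. [folklore] -/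
theorem endLift_mul (u u' : Module.End T M) :
    endLift φ hφinj hspan (u * u') = endLift φ hφinj hspan u ∘ₗ endLift φ hφinj hspan u' :=
  (endLift_unique φ hφinj hspan (u * u') _ fun m => by
    rw [LinearMap.comp_apply, endLift_apply_map, endLift_apply_map]; rfl).symm

/-- `ū` is additive. [folklore] -/
theorem endLift_add (u u' : Module.End T M) :
    endLift φ hφinj hspan (u + u') = endLift φ hφinj hspan u + endLift φ hφinj hspan u' :=
  (endLift_unique φ hφinj hspan (u + u') _ fun m => by
    rw [LinearMap.add_apply, endLift_apply_map, endLift_apply_map, LinearMap.add_apply, map_add]).symm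

/-- `ū` of `a • u` is `a • ū` (`a ∈ T` acting through `K`). [folklore] -/
theorem endLift_smul (a : T) (u : Module.End T M) :
    endLift φ hφinj hspan (a • u) = algebraMap T K a • endLift φ hφinj hspan u :=
  (endLift_unique φ hφinj hspan (a • u) _ fun m => by
    rw [LinearMap.smul_apply, endLift_apply_map, LinearMap.smul_apply, LinearMap.map_smul,
      algebraMap_smul]).symm

end LinearAlgebra

/-! ## The induced endomorphism of the full sheaf `M~ = 𝒪_X · φ(M)` -/

section Sheaf

variable {X : Scheme.{u}} [IsIntegral X]
variable {T : Type*} [CommRing T] [IsDomain T] [Algebra T X.functionField] [IsFractionRing T X.functionField]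
variable {V : Type u} [AddCommGroup V] [Module X.functionField V] [Module T V] [IsScalarTower T X.functionField V]
variable {M : Type*} [AddCommGroup M] [Module T M] (φ : M →ₗ[T] V)
variable (hφinj : Function.Injective φ) (hspan : Submodule.span X.functionField (Set.range φ) = ⊤)
include hφinj hspan

/-- **`sheafEnd u : M~ ⟶ M~`**, the endomorphism of the full sheaf `M~ = 𝒪_X · φ(M)` induced by
`u ∈ End_T(M)` (apply `ū` to the values; `mapOfLinear`). [this work] -/
def sheafEnd (u : Module.End T M) : generatedSheaf (X := X) V (Set.range φ) ⟶ generatedSheaf V (Set.range φ) :=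
  mapOfLinear (endLift φ hφinj hspan u) (endLift_mapsTo φ hφinj hspan u)

/-- Values of `sheafEnd u`: `ū ∘ (values)`. [folklore] -/
@[simp]
theorem fn_sheafEnd_app (u : Module.End T M) (U : X.Opens) (s : Γ(generatedSheaf V (Set.range φ), U))
    (y : U) : fn V (Set.range φ) ((sheafEnd φ hφinj hspan u).app U s) y =
      endLift φ hφinj hspan u (fn V (Set.range φ) s y) := rfl

/-- `sheafEnd u` takes the generating section `σ_{φ m}` to `σ_{φ (u m)}`. [this work] -/
theorem sheafEnd_app_ofMem (u : Module.End T M) (U : X.Opens) (m : M) :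
    (sheafEnd φ hφinj hspan u).app U (ofMem V (Set.range φ) U (φ m) ⟨m, rfl⟩) =
      ofMem V (Set.range φ) U (φ (u m)) ⟨u m, rfl⟩ :=
  section_ext V (Set.range φ) (funext fun y => by
    rw [fn_sheafEnd_app, fn_ofMem, fn_ofMem, endLift_apply_map])

/-- `sheafEnd 1 = 𝟙`. [folklore] -/
theorem sheafEnd_one : sheafEnd (X := X) φ hφinj hspan 1 = 𝟙 _ := by
  refine Scheme.Modules.hom_ext _ _ fun U => ?_
  ext s
  exact section_ext V (Set.range φ) (funext fun y => by rw [fn_sheafEnd_app, endLift_one]; rfl)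

/-- `sheafEnd (u * u') = sheafEnd u' ≫ sheafEnd u`. [folklore] -/
theorem sheafEnd_mul (u u' : Module.End T M) :
    sheafEnd (X := X) φ hφinj hspan (u * u') = sheafEnd φ hφinj hspan u' ≫ sheafEnd φ hφinj hspan u := by
  refine Scheme.Modules.hom_ext _ _ fun U => ?_
  ext s
  exact section_ext V (Set.range φ) (funext fun y => by rw [fn_sheafEnd_app, endLift_mul]; rfl)

/-- `sheafEnd` is additive. [folklore] -/
theorem sheafEnd_add (u u' : Module.End T M) :
    sheafEnd (X := X) φ hφinj hspan (u + u') = sheafEnd φ hφinj hspan u + sheafEnd φ hφinj hspan u' := by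
  refine Scheme.Modules.hom_ext _ _ fun U => ?_
  ext s
  exact section_ext V (Set.range φ) (funext fun y => by rw [fn_sheafEnd_app, endLift_add]; rfl)

end Sheaf

end Summit.ResolutionOfSingularities.ResolutionOfSingularities.Theorems.NoZeno.SandwichCluster.FullSheaf

end
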